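import Literature.AlgebraicGeometry.Frobenioids.NumberFieldLocalizationCategoriesAnyTopology
import Literature.AlgebraicGeometry.Frobenioids.NumberFieldLocalizationCategoriesFSMFF
import Literature.AlgebraicGeometry.Frobenioids.NumberFieldLocalizationsGlue
import Mathlib.GroupTheory.SpecificGroups.Cyclic.Basic
import HarnessLib

/-!
# Frobenioids II, Example 1.4 (ii) / Prop. 1.5 (ix) for an ARBITRARY topology on `G`: `E₀` is of
# FSMFF-type; trivial factorizations in `P₀` (exact-closure witnesses)

Mochizuki, *The geometry of Frobenioids II*, Kyushu J. Math. **62** (2008) 401–460, §1 Example 1.4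
(ii) p. 13 and Proposition 1.5 (ix) p. 15 [cite: MochizukiFrdII2008, Ex. 1.4 (ii) p.13].  PROOF-ONLY
companion of `NumberFieldLocalizationCategories.lean` / `NumberFieldLocalizationsGlue.lean` (seat
abc-iut-L1-t8), continuing `NumberFieldLocalizationCategoriesAnyTopology.lean`.

The typed facts `NFLocCat.EFSMFF G D` and `NFLocCat.PHasTrivialFactorizations G D` have the binders
`(G : Type u) [Group G] [TopologicalSpace G] (D : Subgroup G)` — an ARBITRARY topology on `G`.  The
landed witnesses `eFSMFF_holds` (NumberFieldLocalizationCategoriesFSMFF.lean) and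
`pHasTrivialFactorizations_holds` (NumberFieldLocalizationApplication.lean) assume
`[IsTopologicalGroup G]`, so they do not reach the universal closures as typed (abc-iut FACT-LIST rows
F-1168, F-1175; R7 kernel type-audit DEMOTE:EXTRA-INSTANCE-HYP, abc-iut-w5-d088 gen 2).  Here both
closures are PROVED exactly as typed, by the arguments of those files run over the instance-free
toolkit `BCatOrbitsAnyTopology.lean` and the instance-free FSM-description
`NFLocCat.FSMDescription_closure`.  Stated in closed `∀`-form.  No definitions; nothing here bears on
[IUTchIII].
-/

namespace Literature.AlgebraicGeometry.Frobenioids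

namespace NFLocCat

open CategoryTheory CategoryTheory.Limits
open scoped FintypeCatDiscrete

universe u

variable {G : Type u} [Group G] [TopologicalSpace G]

/-! ### The size of the `Q`-component along FSM-morphisms (arbitrary topology on `G`) -/

/-- Along a morphism of `E₀` with invertible `P`-component which is not an isomorphism, the finite set
underlying the `Q`-component strictly shrinks — arbitrary topology on `G`.
[cite: MochizukiFrdII2008, Ex. 1.4 (ii) p.13] -/
private theorem card_right_lt' (D : Subgroup G) {T T' : ECat G D} (f : T ⟶ T')
    (hl : IsIso f.hom.left) (hni : ¬ IsIso f) :
    Nat.card T'.obj.right.obj.obj.V < Nat.card T.obj.right.obj.obj.V := by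
  obtain ⟨p⟩ := nonempty_left D T
  have hsurj : Function.Surjective f.hom.right.hom.hom.hom :=
    BCat.surjective_of_isConnectedObj' f.hom.right.hom (T.obj.hom.hom.hom p) T'.obj.right.property
  have hinj : ¬ Function.Injective f.hom.right.hom.hom.hom := fun hinj => by
    haveI : IsIso f.hom.right.hom := BCat.isIso_of_bijective _ ⟨hinj, hsurj⟩
    haveI : IsIso f.hom.right := (ObjectProperty.isIso_hom_iff f.hom.right).mp inferInstance
    exact hni (isIso_of_isIso_left_right D f)
  have hle : Nat.card T'.obj.right.obj.obj.V ≤ Nat.card T.obj.right.obj.obj.V :=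
    Nat.card_le_card_of_surjective _ hsurj
  have hne : Nat.card T.obj.right.obj.obj.V ≠ Nat.card T'.obj.right.obj.obj.V := fun h =>
    hinj ((Nat.bijective_iff_surjective_and_card _).mpr ⟨hsurj, h⟩).1
  omega

/-- Along an FSM-morphism of `E₀` which is not an isomorphism the `Q`-component strictly shrinks —
arbitrary topology on `G`. [cite: MochizukiFrdII2008, Ex. 1.4 (ii) p.13] -/
private theorem card_right_lt_of_isFSM' (D : Subgroup G) {T T' : ECat G D} (f : T ⟶ T')
    (hf : IsFSM f) (hni : ¬ IsIso f) :
    Nat.card T'.obj.right.obj.obj.V < Nat.card T.obj.right.obj.obj.V :=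
  card_right_lt' D f ((FSMDescription_closure G D f).mp ⟨hf, hni⟩).1 hni

/-- A chain of `n` FSMI-morphisms of `E₀` out of `(P, Q, ι)` lowers `#Q` by at least `n` — arbitrary
topology on `G`. [cite: MochizukiFrdII2008, Ex. 1.4 (ii) p.13] -/
private theorem chain_card_le' (D : Subgroup G) {A B : ECat G D} {φ : A ⟶ B} {n : ℕ}
    (h : IsFSMIChain φ n) : n + Nat.card B.obj.right.obj.obj.V ≤ Nat.card A.obj.right.obj.obj.V := by
  induction h with
  | single φ hφ =>
    have := card_right_lt_of_isFSM' D φ hφ.1 hφ.2.1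
    omega
  | cons ψ χ n hψ _ ih =>
    have := card_right_lt_of_isFSM' D ψ hψ.1 hψ.2.1
    omega

/-! ### The two exact-closure witnesses -/

/-- FACT-LIST F-1168 — FrdII Ex. 1.4 (ii), p. 13: "one verifies immediately that `E₀` is of
FSMFF-type": the UNIVERSAL CLOSURE of `NFLocCat.EFSMFF` exactly as typed (arbitrary topology on `G`),
PROVED — chains of FSMI-morphisms out of `(P, Q, ι)` have length `≤ #Q`, and a non-irreducible
FSM-morphism factors into two FSM-morphisms with smaller gaps (strong induction), as in `eFSMFF_holds`.
[cite: MochizukiFrdII2008, Ex. 1.4 (ii) p.13] -/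
theorem EFSMFF_closure :
    ∀ (G : Type u) [Group G] [TopologicalSpace G] (D : Subgroup G), EFSMFF G D := by
  intro G _ _ D
  constructor
  · intro T T' φ hφ hni
    suffices main : ∀ (n : ℕ) {T T' : ECat G D} (φ : T ⟶ T'), IsFSM φ → ¬ IsIso φ →
        Nat.card T.obj.right.obj.obj.V ≤ Nat.card T'.obj.right.obj.obj.V + n →
        ∃ m, IsFSMIChain φ m from
      main _ φ hφ hni (Nat.le_add_left _ _)
    intro n
    induction n with
    | zero =>
      intro T T' φ hφ hni hle
      have := card_right_lt_of_isFSM' D φ hφ hni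
      omega
    | succ n ih =>
      intro T T' φ hφ hni hle
      by_cases hirr : IsIrreducibleHom φ
      · exact ⟨1, IsFSMIChain.single φ ⟨hφ, hirr⟩⟩
      have hex : ∃ (X : ECat G D) (β : T ⟶ X) (α : X ⟶ T'), β ≫ α = φ ∧ ¬ IsIso α ∧ ¬ IsIso β := by
        by_contra hcon
        apply hirr
        refine ⟨hni, fun X β α h => ?_⟩
        by_contra hor
        exact hcon ⟨X, β, α, h, fun hα => hor (Or.inl hα), fun hβ => hor (Or.inr hβ)⟩
      obtain ⟨X, β, α, hcomp, hα, hβ⟩ := hex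
      have hφl : IsIso φ.hom.left := ((FSMDescription_closure G D φ).mp ⟨hφ, hni⟩).1
      obtain ⟨p⟩ := nonempty_left D T
      have hcompl : β.hom.left ≫ α.hom.left = φ.hom.left :=
        congrArg (fun k => CommaMorphism.left (InducedCategory.Hom.hom k)) hcomp
      -- the `P`-component of `β` is bijective, hence invertible; then so is that of `α`
      have hβbij : Function.Bijective β.hom.left.hom.hom.hom := by
        refine ⟨fun x y hxy => ?_,
          BCat.surjective_of_isConnectedObj' β.hom.left.hom p X.obj.left.property⟩
        have hφinj := (BCat.bijective_of_isIso φ.hom.left.hom).1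
        apply hφinj
        have ex := congrArg (fun k : T.obj.left ⟶ T'.obj.left => k.hom.hom.hom x) hcompl
        have ey := congrArg (fun k : T.obj.left ⟶ T'.obj.left => k.hom.hom.hom y) hcompl
        exact ex.symm.trans ((congrArg (fun z => α.hom.left.hom.hom.hom z) hxy).trans ey)
      haveI hβl : IsIso β.hom.left := by
        haveI := BCat.isIso_of_bijective β.hom.left.hom hβbij
        exact (ObjectProperty.isIso_hom_iff β.hom.left).mp inferInstance
      have hαl : IsIso α.hom.left := by
        have : α.hom.left = inv β.hom.left ≫ φ.hom.left := by
          rw [← hcompl, IsIso.inv_hom_id_assoc]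
        rw [this]
        infer_instance
      have hβfsm : IsFSM β := ((FSMDescription_closure G D β).mpr ⟨hβl, hβ⟩).1
      have hαfsm : IsFSM α := ((FSMDescription_closure G D α).mpr ⟨hαl, hα⟩).1
      have cβ := card_right_lt_of_isFSM' D β hβfsm hβ
      have cα := card_right_lt_of_isFSM' D α hαfsm hα
      obtain ⟨m₁, h₁⟩ := ih β hβfsm hβ (by omega)
      obtain ⟨m₂, h₂⟩ := ih α hαfsm hα (by omega)
      exact ⟨m₂ + m₁, hcomp ▸ h₁.append h₂⟩
  · intro T
    refine ⟨Nat.card T.obj.right.obj.obj.V, fun {B} φ n h => ?_⟩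
    have := chain_card_le' D h
    omega

/-- In `P₀ = B(D)⁰` a morphism out of a one-point object is an isomorphism — arbitrary topology on
`G`. [cite: MochizukiFrdII2008, Prop. 1.5 (ix) p.15] -/
private theorem isIso_of_subsingleton' (D : Subgroup G) {M B : PCat G D} (α : M ⟶ B)
    (m : M.obj.obj.V) (hM : ∀ m' : M.obj.obj.V, m' = m) : IsIso α := by
  have hsurj : Function.Surjective α.hom.hom.hom :=
    BCat.surjective_of_isConnectedObj' α.hom m B.property
  have hinj : Function.Injective α.hom.hom.hom := fun x y _ => (hM x).trans (hM y).symm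
  haveI : IsIso α.hom := BCat.isIso_of_bijective α.hom ⟨hinj, hsurj⟩
  exact (ObjectProperty.isIso_hom_iff α).mp inferInstance

/-- FACT-LIST F-1175 — obligation `PHasTrivialFactorizations` of `NumberFieldLocalizationsGlue.lean`
(FrdII Prop. 1.5 (ix), proof, p. 15: if `D_v` is trivial or of prime order, then in every composable pair
`β : A → M`, `α : M → B` of `P₀ = B(D_v)⁰` one factor is an isomorphism): the UNIVERSAL CLOSURE of
`NFLocCat.PHasTrivialFactorizations` exactly as typed (arbitrary topology on `G`), PROVED — `M` is a point
(then `α` is bijective) or a free orbit (then `β` is bijective), as in `pHasTrivialFactorizations_holds`.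
[cite: MochizukiFrdII2008, Prop. 1.5 (ix) p.15] -/
theorem PHasTrivialFactorizations_closure :
    ∀ (G : Type u) [Group G] [TopologicalSpace G] (D : Subgroup G), PHasTrivialFactorizations G D := by
  intro G _ _ D hD
  refine ⟨fun {A M B} β α => ?_⟩
  obtain ⟨m⟩ := BCat.nonempty_of_isNonemptyObj _ M.property.1
  obtain ⟨a⟩ := BCat.nonempty_of_isNonemptyObj _ A.property.1
  by_cases hM : ∀ m' : M.obj.obj.V, m' = m
  · exact Or.inl (isIso_of_subsingleton' D α m hM)
  · right
    have htrA := BCat.exists_smul_eq_of_isConnectedObj' A.obj A.property a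
    have htrM := BCat.exists_smul_eq_of_isConnectedObj' M.obj M.property (β.hom.hom.hom a)
    have hsurj : Function.Surjective β.hom.hom.hom :=
      BCat.surjective_of_isConnectedObj' β.hom a M.property
    -- the stabiliser of `β(a)` in `D` is trivial: else all of `D` fixes `β(a)` and `M = {β(a)}`
    have hstab : MulAction.stabilizer D (β.hom.hom.hom a) = ⊥ := by
      have key : MulAction.stabilizer D (β.hom.hom.hom a) = ⊤ → False := fun h => hM fun m' => by
        have hM' : ∀ m'' : M.obj.obj.V, m'' = β.hom.hom.hom a := fun m'' => by
          obtain ⟨d, rfl⟩ := htrM m''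
          have hd : d ∈ MulAction.stabilizer D (β.hom.hom.hom a) := by
            rw [h]; exact Subgroup.mem_top d
          exact MulAction.mem_stabilizer_iff.mp hd
        rw [hM' m', hM' m]
      rcases hD with hbot | hprime
      · subst hbot
        exact Subsingleton.elim _ _
      · haveI : Fact (Nat.card D).Prime := ⟨hprime⟩
        exact ((MulAction.stabilizer (↥D) (β.hom.hom.hom a)).eq_bot_or_eq_top_of_prime_card).resolve_right
          key
    have hinj : Function.Injective β.hom.hom.hom :=
      BCat.injective_of_stabilizer_le β.hom a htrA (by rw [hstab]; exact bot_le)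
    haveI : IsIso β.hom := BCat.isIso_of_bijective β.hom ⟨hinj, hsurj⟩
    exact (ObjectProperty.isIso_hom_iff β).mp inferInstance

end NFLocCat

end Literature.AlgebraicGeometry.Frobenioids
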